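import Literature.NumberTheory.EllipticCurves.BSDQuadraticDescentArchimedeanProofs
import Literature.NumberTheory.EllipticCurves.BSDInvariantsProofs
import HarnessLib

/-!
# Miller 2011, Lemma 2.4: the period relation `Ω(E) · Ω(E^d) · δ^{1/2} = [E(ℝ) : E⁰(ℝ)] · ‖ω‖²` for a quadratic twist by `d < 0` (as printed, and PROVED)

Topic `NumberTheory/EllipticCurves`, story `Miller2011` (R. L. Miller, *Proving the Birch and
Swinnerton-Dyer conjecture for specific elliptic curves of analytic rank zero and one*, LMS J.
Comput. Math. 14 (2011) 327–350 = arXiv:1010.2431; held text `paper:arxiv-1010.2431`, LaTeX-derived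
pages `pNNNN`). Written for the sub-lane `bsd-p2` of the BSD rank-`≤ 1` residual cell (ask A-TY-1
of the `P2/` typer: the exact archimedean factor, with its power of `2`, that converts the
Cai–Shu–Tian / Gross–Zagier constant `‖ω‖² = 2·covol(Λ_E)` into the product of the two REAL
periods `Ω(E)·Ω(E^{d})` entering `#Ш_an(E)·#Ш_an(E^{d})` for the pair `(E, E^{d})`, `d = d_K`).

## The printed statements (verbatim, arXiv:1010.2431 §2 "Quadratic twists")

* Setting [p0005 L3–L5]: *"Suppose `E` is an elliptic curve over `ℚ` given in standardized … global
  minimal Weierstrass form"*; [p0005 L35]: *"noting that `Δ` is the minimal discriminant of `E`,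
  hence `ω = dx/(2y + a₁x + a₃)` is the minimal invariant differential of `E`. Let `Δ'` be the
  minimal discriminant of `E^d`"* (`E^d` the quadratic twist by a square-free integer
  `d ∉ {0, 1}`, [p0005 L3]).
* **Proposition 2.1** [p0005 L40–L68] defines integers `δ_p` for `p ∣ 2d` (a correction of Connell's
  table) and concludes: *"Then `Δ' = Δ δ⁶` where `δ = δ(E,d) = ∏_{p ∣ 2d} p^{δ_p}`."*
* **Lemma 2.4** [p0006 L50–L55]: *"The following lemma is a generalization of a formula which
  appeared in [GZ86] without proof. Lemma 2.4. Suppose `d < 0` is a square-free integer. Then with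
  `δ = δ(E, d)` as defined above, we have:
  `Ω(E) · Ω(E^d) · δ^{1/2} = [E(ℝ) : E⁰(ℝ)] · ‖ω‖²`."*
  Proof [p0006 L57–L62]: *"Let `x` be the least positive real element of the period lattice `Λ`,
  and choose a fundamental domain for `Λ` with base `[0,x] ⊂ ℝ` and upper left corner with positive
  imaginary part `y` … Then `Ω(E)/[E(ℝ):E⁰(ℝ)] = x` and `‖ω‖² = 2xy`. We compute
  `δ^{1/2} Ω(E^d) = δ^{1/2} ∫_{E^d(ℝ)} |ω'| = ∫_{E(ℂ)⁻} δ^{1/2} |φ^*ω'| = ∫_{E(ℂ)⁻} |ω| = 2y`."*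
  (`ω'` = the minimal invariant differential of `E^d` [p0005 L70–L74]; `‖ω‖² = ∫_{E(ℂ)} ω ∧ \overline{iω}`
  [p0009 L14, Thm. 4.1].)

## Translation into the tree's vocabulary (no new notion)

* `Ω(E) = W.realPeriodRat` for a globally minimal `W` (`BSDInvariants`: `∫_{E(ℝ)}|ω|` over ALL real
  components — Miller's `Ω(E) = [E(ℝ):E⁰(ℝ)]·x`); `Ω(E^d) = Wd.realPeriodRat` for `Wd` a globally
  minimal model of the twist, `C • W.quadraticTwist d = Wd` (`QuadraticTwist`; the standard
  phrasing of `Pal2012/QuadraticTwistPeriod.lean`, `Milne1972/…`).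
* `‖ω‖² = 2xy = 2·covol(Λ_ω) = (W.baseChange ℂ).complexPeriod` (`ComplexPeriod`: "`∫_{E(ℂ)}|ω ∧ ω̄|`
  … i.e. `2 · covol(Λ_ω)`").
* `[E(ℝ) : E⁰(ℝ)] = (W.baseChange ℝ).numRealComponents` (`RealPeriod`: `2` if `Δ > 0`, else `1`).
* `δ`: the printed `δ(E,d)` is the positive rational number with `Δ' = Δ·δ⁶` (Prop. 2.1), i.e. it is
  DETERMINED by the two minimal discriminants; the fact below takes `δ` as a binder with exactly
  this defining property (`Wd.Δ = W.Δ * δ ^ 6`, `0 < δ`), so no case table is needed and the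
  statement is the printed one for the printed `δ`.

## What is here

* `lemma24_realPeriod_mul_realPeriod_twist_mul_sqrt` — Lemma 2.4 as printed (named statement,
  `def … : Prop`), and `lemma24_realPeriod_mul_realPeriod_twist_mul_sqrt_holds` — its PROOF, so the
  named statement carries no debt;
* `realPeriodRat_mul_realPeriodRat_twist_mul_sqrt_eq` — the model-free form actually proved: for
  ANY elliptic `W/ℚ`, ANY rational `d < 0`, ANY model `Wd = C • W.quadraticTwist d` and the `δ > 0`
  with `Δ(Wd) = Δ(W)·δ⁶`, `Ω(W)·Ω(Wd)·√δ = n(W)·‖ω_W‖²` (both sides scale by `u²` under a change of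
  model of `W` and are invariant under a change of model of `Wd`, so minimality and
  square-freeness are not used).

Proof: the tree already PROVES the archimedean comparison for the tree's own (non-minimal) twist
model, `WeierstrassCurve.realPeriod_mul_realPeriod_quadraticTwist_mul_sqrt`
(`BSDQuadraticDescentArchimedeanProofs`): `Ω(W)·Ω(W.quadraticTwist d)·√(−d) = n·‖ω‖²` over `ℝ`.
If `Wd = C • W.quadraticTwist d` with scaling `u = C.u`, then `Ω(Wd) = |u|·Ω(W.quadraticTwist d)`
(`realPeriodRat_smul_holds`, Silverman AEC III Table 3.1) and `Δ(Wd) = u⁻¹²·d⁶·Δ(W)`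
(`variableChange_Δ`, `quadraticTwist_Δ`), so `δ⁶ = d⁶/u¹²`, `δ = −d/u²`, `√δ = √(−d)/|u|`, and the
two factors `|u|` cancel. (This is Miller's proof: his `φ^*ω' = ±|δ/d|^{-1/2} θ ω` is the same
bookkeeping of the scaling between the twist model and its minimal model.)

## References
* R. L. Miller, LMS J. Comput. Math. 14 (2011) 327–350, §2: Prop. 2.1, Lemma 2.4; §4 Thm. 4.1
  (normalisation of `‖ω‖²`). arXiv:1010.2431. [Miller2011LMS]
* B. H. Gross, D. B. Zagier, Invent. Math. 84 (1986) 225–320 (the formula "which appeared in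
  [GZ86] without proof", loc. cit.). [GrossZagierInvent1986]
* J. E. Cremona, *Algorithms for Modular Elliptic Curves*, 2nd ed., §3.7 (real period over all
  components; rectangular / rhombic period lattices). [CremonaAlgorithms1997]
-/

noncomputable section

open scoped Classical

open WeierstrassCurve

namespace Literature.NumberTheory.EllipticCurves.Miller2011

/-- **Miller 2011, Lemma 2.4 (as printed).** R. L. Miller, LMS J. Comput. Math. 14 (2011), §2,
arXiv:1010.2431 p. 6 L50–L55, verbatim: *"Suppose `d < 0` is a square-free integer. Then with
`δ = δ(E, d)` as defined above, we have: `Ω(E) · Ω(E^d) · δ^{1/2} = [E(ℝ) : E⁰(ℝ)] · ‖ω‖²`."*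
Here (loc. cit. §2, p. 5 L3–L5, L35; Prop. 2.1, p. 5 L40–L68): `E/ℚ` is given by a global minimal
Weierstrass equation with minimal discriminant `Δ` and minimal invariant differential `ω`, `E^d` is
its quadratic twist by `d` with minimal discriminant `Δ'`, `δ = δ(E,d)` is the positive rational
number of Prop. 2.1, characterised there by *"`Δ' = Δ δ⁶`"*, `Ω(E) = ∫_{E(ℝ)}|ω|` and
`Ω(E^d) = ∫_{E^d(ℝ)}|ω'|` are the real periods of the minimal differentials over ALL real components
(proof, p. 6 L57: *"`Ω(E)/[E(ℝ):E⁰(ℝ)] = x`"*, `x` the least positive real period), and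
`‖ω‖² = ∫_{E(ℂ)} ω ∧ \overline{iω} = 2xy` (p. 6 L57, p. 9 L14) is twice the covolume of the period
lattice. Tree translation: `W` globally minimal over `ℚ` (`Ω(E) = W.realPeriodRat`,
`‖ω‖² = (W.baseChange ℂ).complexPeriod = 2·covol(Λ_ω)`, `[E(ℝ):E⁰(ℝ)] = (W.baseChange ℝ).numRealComponents`);
`Wd` a globally minimal model of the twist (`C • W.quadraticTwist d = Wd`, `Ω(E^d) = Wd.realPeriodRat`);
`δ : ℚ` with `0 < δ` and `Wd.Δ = W.Δ * δ ^ 6` (this pins `δ = δ(E,d)`). PROVED below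
(`lemma24_realPeriod_mul_realPeriod_twist_mul_sqrt_holds`). "A generalization of a formula which
appeared in [GZ86] without proof" (loc. cit.).
[cite: Miller2011LMS, Lemma 2.4 (arXiv:1010.2431 p. 6 L50–L62) with Prop. 2.1 (p. 5 L40–L68) and Thm. 4.1 (p. 9 L14)] -/
def lemma24_realPeriod_mul_realPeriod_twist_mul_sqrt : Prop :=
  ∀ (W : WeierstrassCurve ℚ) [W.IsElliptic] [W.IsGloballyMinimal] (d : ℤ),
    Squarefree d → d < 0 →
    ∀ (Wd : WeierstrassCurve ℚ) [Wd.IsElliptic] [Wd.IsGloballyMinimal],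
      (∃ C : VariableChange ℚ, C • W.quadraticTwist (d : ℚ) = Wd) →
      ∀ δ : ℚ, 0 < δ → Wd.Δ = W.Δ * δ ^ 6 →
        W.realPeriodRat * Wd.realPeriodRat * Real.sqrt (δ : ℝ) =
          (W.baseChange ℝ).numRealComponents * (W.baseChange ℂ).complexPeriod

/-- Base change commutes with the quadratic twist (the twist is given by universal formulas in the
`bᵢ`). Private copy of `WeierstrassCurve.map_quadraticTwist` (file `QuadraticTwistPadicReduction`,
not imported here). [folklore] -/
private theorem map_quadraticTwist_aux {F L : Type*} [Field F] [Field L] (V : WeierstrassCurve F)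
    (f : F →+* L) (d : F) : (V.quadraticTwist d).map f = (V.map f).quadraticTwist (f d) := by
  ext
  · simp
  · simp [map_div₀, map_ofNat]
  · simp
  · simp [map_div₀, map_ofNat]
  · simp [map_div₀, map_ofNat]

/-- **The model-free form of Miller's Lemma 2.4.** For an elliptic curve `W/ℚ` (any model), a
rational `d < 0`, ANY model `Wd = C • W.quadraticTwist d` of the quadratic twist by `d`, and the
positive rational `δ` with `Δ(Wd) = Δ(W)·δ⁶` (it exists and is unique: `δ = −d/u²`, `u = C.u`):
`Ω(W) · Ω(Wd) · √δ = n(W) · ‖ω_W‖²`, where `Ω = realPeriodRat` (all real components),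
`n(W) = numRealComponents (W ⊗ ℝ) ∈ {1,2}` and `‖ω_W‖² = complexPeriod (W ⊗ ℂ) = 2·covol(Λ_{ω_W})`.
From the tree's proved archimedean comparison
`WeierstrassCurve.realPeriod_mul_realPeriod_quadraticTwist_mul_sqrt`
(`Ω(W)·Ω(W.quadraticTwist d)·√(−d) = n·‖ω‖²`) and `Ω(C • V) = |u|·Ω(V)`
(`realPeriodRat_smul_holds`), `Δ(C • V) = u⁻¹² Δ(V)`, `Δ(V^{(d)}) = d⁶ Δ(V)`: `δ = −d/u²` and the
factors `|u|` cancel. Miller 2011, proof of Lemma 2.4 (arXiv:1010.2431 p. 6 L57–L62).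
[cite: Miller2011LMS, Lemma 2.4 and its proof (arXiv:1010.2431 p. 6 L50–L62)] -/
theorem realPeriodRat_mul_realPeriodRat_twist_mul_sqrt_eq (W : WeierstrassCurve ℚ) [W.IsElliptic]
    {d : ℚ} (hd : d < 0) (Wd : WeierstrassCurve ℚ) (C : VariableChange ℚ)
    (hC : C • W.quadraticTwist d = Wd) {δ : ℚ} (hδ : 0 < δ) (hΔ : Wd.Δ = W.Δ * δ ^ 6) :
    W.realPeriodRat * Wd.realPeriodRat * Real.sqrt (δ : ℝ) =
      (W.baseChange ℝ).numRealComponents * (W.baseChange ℂ).complexPeriod := by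
  have hWΔ : W.Δ ≠ 0 := W.isUnit_Δ.ne_zero
  have hu0 : (C.u : ℚ) ≠ 0 := C.u.ne_zero
  -- Step 1 (discriminants): `Δ(Wd) · u¹² = d⁶ · Δ(W)`, hence `δ · u² = −d`.
  have hΔtw : Wd.Δ * (C.u : ℚ) ^ 12 = d ^ 6 * W.Δ := by
    rw [← hC, variableChange_Δ, quadraticTwist_Δ]
    simp only [Units.val_inv_eq_inv_val]
    field_simp
  have h6 : (δ * (C.u : ℚ) ^ 2) ^ 6 = (-d) ^ 6 := by
    have h := hΔtw
    rw [hΔ] at h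
    have h' : δ ^ 6 * (C.u : ℚ) ^ 12 = d ^ 6 := by
      apply mul_left_cancel₀ hWΔ
      linear_combination h
    calc (δ * (C.u : ℚ) ^ 2) ^ 6 = δ ^ 6 * (C.u : ℚ) ^ 12 := by ring
      _ = d ^ 6 := h'
      _ = (-d) ^ 6 := by ring
  have hδu : δ * (C.u : ℚ) ^ 2 = -d :=
    (pow_left_inj₀ (by positivity) (by linarith) (by norm_num : (6 : ℕ) ≠ 0)).mp h6
  have hδ' : (δ : ℝ) = -(d : ℝ) / ((C.u : ℚ) : ℝ) ^ 2 := by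
    have hq : δ = -d / (C.u : ℚ) ^ 2 := by
      rw [eq_div_iff (pow_ne_zero 2 hu0)]
      exact hδu
    rw [hq]
    push_cast
    ring
  -- Step 2 (square roots): `√δ = √(−d)/|u|`.
  have hsqrt : Real.sqrt (δ : ℝ) = Real.sqrt (-(d : ℝ)) / |((C.u : ℚ) : ℝ)| := by
    rw [hδ', Real.sqrt_div' _ (sq_nonneg _), Real.sqrt_sq_eq_abs]
  -- Step 3 (real periods): `Ω(Wd) = |u| · Ω(W.quadraticTwist d)`.
  have hΩd : Wd.realPeriodRat = |((C.u : ℚ) : ℝ)| * (W.quadraticTwist d).realPeriodRat := by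
    rw [← hC]
    exact (W.quadraticTwist d).realPeriodRat_smul_holds C
  -- Step 4: the tree's archimedean comparison for the model `W.quadraticTwist d`, over `ℝ`.
  haveI : (W.baseChange ℝ).IsElliptic := by rw [WeierstrassCurve.baseChange]; infer_instance
  have hdR : ((d : ℚ) : ℝ) < 0 := by exact_mod_cast hd
  have key := (W.baseChange ℝ).realPeriod_mul_realPeriod_quadraticTwist_mul_sqrt hdR
  have htw : (W.quadraticTwist d).baseChange ℝ = (W.baseChange ℝ).quadraticTwist ((d : ℚ) : ℝ) := by
    rw [WeierstrassCurve.baseChange, map_quadraticTwist_aux, eq_ratCast]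
    rfl
  have hmap : (W.baseChange ℝ).map (algebraMap ℝ ℂ) = W.baseChange ℂ := by
    rw [WeierstrassCurve.baseChange, WeierstrassCurve.baseChange, map_map]
    congr 1
  rw [hmap, ← htw, ← realPeriodRat_def, ← realPeriodRat_def] at key
  -- Step 5: assemble (the factors `|u|` cancel).
  have hua : |((C.u : ℚ) : ℝ)| ≠ 0 := abs_ne_zero.mpr (by exact_mod_cast hu0)
  calc W.realPeriodRat * Wd.realPeriodRat * Real.sqrt (δ : ℝ)
      = W.realPeriodRat * (|((C.u : ℚ) : ℝ)| * (W.quadraticTwist d).realPeriodRat) *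
          (Real.sqrt (-(d : ℝ)) / |((C.u : ℚ) : ℝ)|) := by rw [hΩd, hsqrt]
    _ = W.realPeriodRat * (W.quadraticTwist d).realPeriodRat * Real.sqrt (-(d : ℝ)) := by
          field_simp
    _ = (W.baseChange ℝ).numRealComponents * (W.baseChange ℂ).complexPeriod := key

/-- **Proof of Miller 2011, Lemma 2.4** (discharge of the named statement
`lemma24_realPeriod_mul_realPeriod_twist_mul_sqrt`): the printed hypotheses (`E` globally minimal,
`d` a square-free negative integer, `E^d` by its minimal model) are a special case of the
model-free `realPeriodRat_mul_realPeriodRat_twist_mul_sqrt_eq`.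
[cite: Miller2011LMS, Lemma 2.4 (arXiv:1010.2431 p. 6 L50–L62)] -/
theorem lemma24_realPeriod_mul_realPeriod_twist_mul_sqrt_holds :
    lemma24_realPeriod_mul_realPeriod_twist_mul_sqrt := by
  intro W _ _ d _ hd Wd _ _ hC δ hδ hΔ
  obtain ⟨C, hC⟩ := hC
  have hd' : (d : ℚ) < 0 := by exact_mod_cast hd
  exact realPeriodRat_mul_realPeriodRat_twist_mul_sqrt_eq W hd' Wd C hC hδ hΔ

end Literature.NumberTheory.EllipticCurves.Miller2011

end
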